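import Summits.KontsevichZagierPeriods.KontsevichZagierPeriods.Theorems.IsogenyCertificatesXMapKernelStubNonCMClass
import Summits.KontsevichZagierPeriods.KontsevichZagierPeriods.Theorems.IsogenyCertificatesAlgebraicModuliRealPeriodCellPeriodRep

/-!
# `AlgebraicModuliRealPeriodCell` (stmt-KontsevichZagierPeriods-18265, route IsogenyCertificates) —
line `Sketch`, stub **Ic**: the class kernel (`stub_algClassKernel`)

**Statement (Ic).** Given stub Ib of the line (a REAL lattice multiplier `νΛ ⊆ Λ'` between the period
lattices of nonsingular real-algebraic cubics is realised by a real-algebraic x-rational datum) as a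
HYPOTHESIS: let `Λ₀` be a lattice with invariants `g₂ = −4α_{i₀}`, `g₃ = −4β_{i₀}` (real algebraic) and
`S` a finite set of nonsingular real-algebraic cubics `Pⱼ = x³ + αⱼx + βⱼ` whose period lattices `Λⱼ`
(invariants `(−4αⱼ, −4βⱼ)`) all receive a non-zero complex multiple `μⱼΛ₀ ⊆ Λⱼ`, pairwise NOT joined by
a real-algebraic datum. Then `∑_{j ∈ S} qⱼ Ωⱼ = 0`, `Ωⱼ = ∫_{Pⱼ>0} dx/√Pⱼ`, `qⱼ` real algebraic, forces
`qⱼ = 0` on `S`.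

**Proof.**
1. *Conjugation symmetrisation* (`exists_real_or_imaginary_multiplier`; adapted from the line's ideation
   workfile `Cruxes/AlgebraicModuliRealPeriodCell/SketchIdeator1.lean`). All lattices are real
   (`isReal_of_g₂_g₃_real`), so with `μ` also `μ̄`, `μ + μ̄ = 2 Re μ`, `μ − μ̄ = 2i Im μ` are multipliers:
   every `j ∈ S` is of real type (`νⱼΛ₀ ⊆ Λⱼ`, `νⱼ ∈ ℝ ∖ 0`) or of imaginary type (`iνⱼΛ₀ ⊆ Λⱼ`).
2. *At most one index of each type.* The dual multiplier `(N/γ)Λ ⊆ Λ₀` of `γΛ₀ ⊆ Λ` (finite index,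
   `exists_dual_multiplier`) composes with a multiplier of the same type into a REAL non-zero multiplier
   `(ν'N/ν)Λⱼ ⊆ Λⱼ'` (`exists_real_multiplier_of_real_real`, `…_of_imag_imag`), which Ib turns into a datum,
   excluded by hypothesis unless `j = j'`.
3. *CM.* A real self-multiplier is an integer (`exists_int_of_real_mul_mem`), so under CM `Λ₀` has a
   purely imaginary self-multiplier `iν'` (`exists_imaginary_multiplier_of_hasCM`) and an imaginary-type
   index is of real type too (`(iν)(iν') = −νν'`): `S` has at most one element, and `qⱼΩⱼ = 0`, `Ωⱼ > 0`.
4. *No CM, `S = {r, s}`* (`r` real, `s` imaginary). With `Ωⱼ = nⱼΩ₀(Λⱼ)` (`PeriodRep.exists_periodPair`,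
   `uniformization_unique_holds`), transport `Ω₀(Λ_r)`, `Ω₀(Λ_s)` to `x = (N/ν_r)Ω₀(Λ_r) ∈ Λ₀ ∩ ℝ` and
   `iy = (N'/(iν_s))Ω₀(Λ_s) ∈ Λ₀ ∩ iℝ`; the relation reads `A x + B y = 0` with `A = q_r n_r ν_r/N`,
   `B = −q_s n_s ν_s/N'` real ALGEBRAIC (`ν_r, ν_s ∈ ℚ̄` by `isAlgebraic_of_mul_mem_lattice`). Writing
   `x = aω₁ + bω₂`, `iy = cω₁ + dω₂` gives `(Aa − iBc)ω₁ + (Ab − iBd)ω₂ = 0`, Masser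
   (`NonCMClass.indep_omega`) kills both coefficients, and real/imaginary parts give `A = B = 0`
   (`real_imag_relation`), i.e. `q_r = q_s = 0`.

No definitions, no new named facts; the only transcendence input is Masser's theorem (proved in the
tree). References: D. Masser, *Elliptic Functions and Transcendence*, LNM 437 (1975), Ch. II Thm. II;
J. H. Silverman, *Advanced Topics in the Arithmetic of Elliptic Curves* (1994), §V.2; D. F. Lawden,
*Elliptic Functions and Applications* (1989), §6.15; J. H. Silverman, *The Arithmetic of Elliptic
Curves* (2009), Thm. VI.5.1, Cor. VI.5.1.1, C.16.
-/

noncomputable section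

namespace Summit.KontsevichZagierPeriods.IsogenyCertificates.AlgRealPeriodCell.ClassKernel

open scoped BigOperators ComplexConjugate
open Complex Literature.NumberTheory.Transcendental
open Summit.KontsevichZagierPeriods.IsogenyCertificates.XMapKernelStubs

/-! ## §1 Conjugation symmetrisation of multipliers between real lattices -/

-- §1 is adapted from Cruxes/AlgebraicModuliRealPeriodCell/SketchIdeator1.lean (`conj_multiplier`,
-- `conjSymm_multiplier`, `multiplier_real_int`, `cm_imaginary_multiplier`; an ideation workfile)
/-- Between REAL lattices the conjugate of a multiplier is a multiplier. [folklore] -/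
theorem conj_mul_mem_lattice {L L' : PeriodPair} (hL : L.IsReal) (hL' : L'.IsReal) {α : ℂ}
    (hα : ∀ l ∈ L.lattice, α * l ∈ L'.lattice) (l : ℂ) (hl : l ∈ L.lattice) :
    conj α * l ∈ L'.lattice := by
  have h := hL' _ (hα _ (hL l hl))
  rwa [map_mul, Complex.conj_conj] at h

/-- **Conjugation symmetrisation.** If a real lattice `Λ'` receives a non-zero complex multiple
`αΛ ⊆ Λ'` of a real lattice `Λ`, then `α + ᾱ = 2 Re α` and `α − ᾱ = 2i Im α` are multipliers too and
one of them is non-zero: there is a REAL `ν ≠ 0` with `νΛ ⊆ Λ'` (real type) or `iνΛ ⊆ Λ'` (imaginary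
type). [folklore] -/
theorem exists_real_or_imaginary_multiplier {L L' : PeriodPair} (hL : L.IsReal) (hL' : L'.IsReal)
    {α : ℂ} (hα0 : α ≠ 0) (hα : ∀ l ∈ L.lattice, α * l ∈ L'.lattice) :
    ∃ ν : ℝ, ν ≠ 0 ∧ ((∀ l ∈ L.lattice, (ν : ℂ) * l ∈ L'.lattice) ∨
      (∀ l ∈ L.lattice, (ν : ℂ) * I * l ∈ L'.lattice)) := by
  by_cases hre : α.re = 0
  · have him : α.im ≠ 0 := fun him =>
      hα0 (Complex.ext (by rw [hre, zero_re]) (by rw [him, zero_im]))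
    refine ⟨2 * α.im, mul_ne_zero two_ne_zero him, Or.inr fun l hl => ?_⟩
    rw [← Complex.sub_conj, sub_mul]
    exact sub_mem (hα l hl) (conj_mul_mem_lattice hL hL' hα l hl)
  · refine ⟨2 * α.re, mul_ne_zero two_ne_zero hre, Or.inl fun l hl => ?_⟩
    rw [← Complex.add_conj, add_mul]
    exact add_mem (hα l hl) (conj_mul_mem_lattice hL hL' hα l hl)

/-- A REAL multiplier of a lattice into itself is an integer (`αω₁ = aω₁ + bω₂` with `α` real and
`ω₁, ω₂` independent over `ℝ` forces `b = 0`, `α = a`). [folklore] -/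
theorem exists_int_of_real_mul_mem {L : PeriodPair} {α : ℂ} (hreal : α.im = 0)
    (hα : ∀ l ∈ L.lattice, α * l ∈ L.lattice) : ∃ n : ℤ, α = n := by
  obtain ⟨a, b, hab⟩ := PeriodPair.mem_lattice.1 (hα _ L.ω₁_mem_lattice)
  have hre : ((α.re : ℝ) : ℂ) = α := Complex.ext (by rw [ofReal_re]) (by rw [ofReal_im, hreal])
  have hind := LinearIndependent.pair_iff.mp L.indep (α.re - a) (-b) (by
    simp only [Complex.real_smul]
    push_cast
    linear_combination -hab + L.ω₁ * hre)
  refine ⟨a, ?_⟩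
  rw [← hre, show α.re = a by linarith [hind.1]]
  norm_cast

/-- **CM edge.** A real lattice with complex multiplication has a PURELY IMAGINARY multiplier `iν`,
`ν ∈ ℝ ∖ 0` (namely `α − ᾱ` for a non-integral, hence non-real, multiplier `α`). [folklore] -/
theorem exists_imaginary_multiplier_of_hasCM {L : PeriodPair} (hL : L.IsReal) (h : L.HasCM) :
    ∃ ν : ℝ, ν ≠ 0 ∧ ∀ l ∈ L.lattice, (ν : ℂ) * I * l ∈ L.lattice := by
  obtain ⟨α, hαn, hα⟩ := h
  have him : α.im ≠ 0 := fun him => by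
    obtain ⟨n, hn⟩ := exists_int_of_real_mul_mem him hα
    exact hαn n hn
  refine ⟨2 * α.im, mul_ne_zero two_ne_zero him, fun l hl => ?_⟩
  rw [← Complex.sub_conj, sub_mul]
  exact sub_mem (hα l hl) (conj_mul_mem_lattice hL hL hα l hl)

/-- In the CM case an imaginary-type lattice is of real type: `iνΛ₀ ⊆ Λ` and `iν'Λ₀ ⊆ Λ₀` compose to
`(−νν')Λ₀ ⊆ Λ`. [folklore] -/
theorem exists_real_multiplier_of_imag_cm {L₀ L : PeriodPair} {ν ν' : ℝ} (hν : ν ≠ 0) (hν' : ν' ≠ 0)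
    (hcm : ∀ l ∈ L₀.lattice, (ν' : ℂ) * I * l ∈ L₀.lattice)
    (hνL : ∀ l ∈ L₀.lattice, (ν : ℂ) * I * l ∈ L.lattice) :
    ∃ ρ : ℝ, ρ ≠ 0 ∧ ∀ l ∈ L₀.lattice, (ρ : ℂ) * l ∈ L.lattice := by
  refine ⟨-(ν * ν'), neg_ne_zero.2 (mul_ne_zero hν hν'), fun l hl => ?_⟩
  have e : ((-(ν * ν') : ℝ) : ℂ) * l = (ν : ℂ) * I * ((ν' : ℂ) * I * l) := by
    push_cast
    linear_combination (-(ν : ℂ) * ν' * l) * I_mul_I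
  rw [e]
  exact hνL _ (hcm l hl)

/-! ## §2 Dual multipliers and composition -/

/-- **Dual multiplier** (the dual isogeny): if `γ ≠ 0` and `γΛ ⊆ Λ'`, then `(N/γ)Λ' ⊆ Λ` for some
integer `N ≥ 1` — `Λ ⊆ γ⁻¹Λ'` has finite index (`exists_nat_mul_mem_of_le`). [folklore] -/
theorem exists_dual_multiplier {L L' : PeriodPair} {γ : ℂ} (hγ : γ ≠ 0)
    (hγL : ∀ l ∈ L.lattice, γ * l ∈ L'.lattice) :
    ∃ N : ℕ, N ≠ 0 ∧ ∀ y ∈ L'.lattice, (N : ℂ) / γ * y ∈ L.lattice := by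
  have hγi : γ⁻¹ ≠ 0 := inv_ne_zero hγ
  have hle : L.lattice ≤ (L'.mulLeft γ⁻¹ hγi).lattice := fun l hl =>
    PeriodPair.mem_mulLeft_lattice.2 (by rw [inv_inv]; exact hγL l hl)
  obtain ⟨N, hN, hNM⟩ := HuberWustholzSplitting.exists_nat_mul_mem_of_le hle
  refine ⟨N, hN, fun y hy => ?_⟩
  have h := hNM _ (PeriodPair.mul_mem_mulLeft_lattice.2 hy : γ⁻¹ * y ∈ (L'.mulLeft γ⁻¹ hγi).lattice)
  rwa [← mul_assoc, ← div_eq_mul_inv] at h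

/-- **Two lattices of real type are joined by a real multiplier**: `νΛ₀ ⊆ Λ`, `ν'Λ₀ ⊆ Λ'`
(`ν, ν' ∈ ℝ ∖ 0`) give `(ν'N/ν)Λ ⊆ Λ'` with the dual `(N/ν)Λ ⊆ Λ₀`. [folklore] -/
theorem exists_real_multiplier_of_real_real {L₀ L L' : PeriodPair} {ν ν' : ℝ} (hν : ν ≠ 0)
    (hν' : ν' ≠ 0) (hνL : ∀ l ∈ L₀.lattice, (ν : ℂ) * l ∈ L.lattice)
    (hν'L : ∀ l ∈ L₀.lattice, (ν' : ℂ) * l ∈ L'.lattice) :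
    ∃ ρ : ℝ, ρ ≠ 0 ∧ ∀ y ∈ L.lattice, (ρ : ℂ) * y ∈ L'.lattice := by
  obtain ⟨N, hN, hNL⟩ := exists_dual_multiplier (ofReal_ne_zero.2 hν) hνL
  refine ⟨ν' * (N / ν), mul_ne_zero hν' (div_ne_zero (Nat.cast_ne_zero.2 hN) hν), fun y hy => ?_⟩
  have e : ((ν' * (N / ν) : ℝ) : ℂ) * y = (ν' : ℂ) * ((N : ℂ) / ν * y) := by
    push_cast
    ring
  rw [e]
  exact hν'L _ (hNL y hy)

/-- **Two lattices of imaginary type are joined by a real multiplier**: `iνΛ₀ ⊆ Λ`, `iν'Λ₀ ⊆ Λ'`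
(`ν, ν' ∈ ℝ ∖ 0`) give `(ν'N/ν)Λ ⊆ Λ'`, since `(iν')·N/(iν) = ν'N/ν`. [folklore] -/
theorem exists_real_multiplier_of_imag_imag {L₀ L L' : PeriodPair} {ν ν' : ℝ} (hν : ν ≠ 0)
    (hν' : ν' ≠ 0) (hνL : ∀ l ∈ L₀.lattice, (ν : ℂ) * I * l ∈ L.lattice)
    (hν'L : ∀ l ∈ L₀.lattice, (ν' : ℂ) * I * l ∈ L'.lattice) :
    ∃ ρ : ℝ, ρ ≠ 0 ∧ ∀ y ∈ L.lattice, (ρ : ℂ) * y ∈ L'.lattice := by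
  have hνI : (ν : ℂ) * I ≠ 0 := mul_ne_zero (ofReal_ne_zero.2 hν) I_ne_zero
  obtain ⟨N, hN, hNL⟩ := exists_dual_multiplier hνI hνL
  refine ⟨ν' * (N / ν), mul_ne_zero hν' (div_ne_zero (Nat.cast_ne_zero.2 hN) hν), fun y hy => ?_⟩
  have e : ((ν' * (N / ν) : ℝ) : ℂ) * y = (ν' : ℂ) * I * ((N : ℂ) / ((ν : ℂ) * I) * y) := by
    rw [div_mul_eq_div_mul_one_div (N : ℂ) (ν : ℂ) I, one_div, Complex.inv_I]
    push_cast
    linear_combination ((ν' : ℂ) * ((N : ℂ) / ν) * y) * I_mul_I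
  rw [e]
  exact hν'L _ (hNL y hy)

/-- The real number `ν` of an imaginary-type multiplier `iνΛ₀ ⊆ Λ`, `ν ≠ 0`, between lattices with
algebraic invariants is algebraic (`iν` is, `isAlgebraic_of_mul_mem_lattice`; `ν = (iν)(−i)`). [folklore] -/
theorem isAlgebraic_of_imaginary_multiplier {L₀ L : PeriodPair} (h₂ : IsAlgebraic ℚ L₀.g₂)
    (h₃ : IsAlgebraic ℚ L₀.g₃) (h₂' : IsAlgebraic ℚ L.g₂) (h₃' : IsAlgebraic ℚ L.g₃) {ν : ℝ}
    (hν : ν ≠ 0) (hνL : ∀ l ∈ L₀.lattice, (ν : ℂ) * I * l ∈ L.lattice) : IsAlgebraic ℚ (ν : ℂ) := by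
  have h := HuberWustholzSplitting.isAlgebraic_of_mul_mem_lattice h₂ h₃ h₂' h₃'
    (mul_ne_zero (ofReal_ne_zero.2 hν) I_ne_zero) hνL
  have hI : IsAlgebraic ℚ I :=
    IsAlgebraic.of_pow (r := I) (n := 2) (by norm_num) (by rw [I_sq]; exact isAlgebraic_one.neg)
  have h' := h.mul hI.neg
  rwa [mul_assoc, mul_neg, I_mul_I, neg_neg, mul_one] at h'

/-! ## §3 Masser in real/imaginary form -/

/-- **Masser, real/imaginary form.** For a lattice `Λ₀` with algebraic invariants and no complex
multiplication, `x ∈ Λ₀ ∩ ℝ` and `iy ∈ Λ₀ ∩ iℝ` with `x, y ≠ 0`: a relation `A x + B y = 0` with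
`A, B` real algebraic is trivial. Write `x = aω₁ + bω₂`, `iy = cω₁ + dω₂` with integers `a, b, c, d`;
then `A x − iB(iy) = (Aa − iBc)ω₁ + (Ab − iBd)ω₂ = 0`, both coefficients vanish by Masser
(`NonCMClass.indep_omega`), and their real and imaginary parts give `Aa = Ab = 0`, `Bc = Bd = 0`,
while `(a, b) ≠ 0` (`x ≠ 0`) and `(c, d) ≠ 0` (`y ≠ 0`). [cite: Masser1975, Ch. II Thm. II] -/
theorem real_imag_relation {L₀ : PeriodPair} (h₂ : IsAlgebraic ℚ L₀.g₂) (h₃ : IsAlgebraic ℚ L₀.g₃)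
    (hCM : ¬ L₀.HasCM) {x y A B : ℝ} (hx : x ≠ 0) (hy : y ≠ 0) (hxL : (x : ℂ) ∈ L₀.lattice)
    (hyL : (y : ℂ) * I ∈ L₀.lattice) (hA : IsAlgebraic ℚ (A : ℂ)) (hB : IsAlgebraic ℚ (B : ℂ))
    (h : A * x + B * y = 0) : A = 0 ∧ B = 0 := by
  obtain ⟨a, b, hab⟩ := PeriodPair.mem_lattice.1 hxL
  obtain ⟨c, d, hcd⟩ := PeriodPair.mem_lattice.1 hyL
  have h' : (A : ℂ) * x + B * y = 0 := by exact_mod_cast h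
  have hI : IsAlgebraic ℚ I :=
    IsAlgebraic.of_pow (r := I) (n := 2) (by norm_num) (by rw [I_sq]; exact isAlgebraic_one.neg)
  -- the relation in the basis `ω₁, ω₂`
  have hrel : ((A : ℂ) * a - I * B * c) * L₀.ω₁ + ((A : ℂ) * b - I * B * d) * L₀.ω₂ = 0 := by
    have e : ((A : ℂ) * a - I * B * c) * L₀.ω₁ + ((A : ℂ) * b - I * B * d) * L₀.ω₂
        = (A : ℂ) * ((a : ℂ) * L₀.ω₁ + b * L₀.ω₂) - I * B * ((c : ℂ) * L₀.ω₁ + d * L₀.ω₂) := by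
      ring
    rw [e, hab, hcd]
    linear_combination h' - (B : ℂ) * y * I_mul_I
  obtain ⟨hA0, hB0⟩ := NonCMClass.indep_omega h₂ h₃ hCM
    ((hA.mul (isAlgebraic_int a)).sub ((hI.mul hB).mul (isAlgebraic_int c)))
    ((hA.mul (isAlgebraic_int b)).sub ((hI.mul hB).mul (isAlgebraic_int d))) hrel
  -- real and imaginary parts
  have key : ∀ {m₁ m₂ : ℤ}, (A : ℂ) * m₁ - I * B * m₂ = 0 → A * m₁ = 0 ∧ B * m₂ = 0 := by
    intro m₁ m₂ hm
    have e₁ := congrArg Complex.re hm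
    have e₂ := congrArg Complex.im hm
    simp only [sub_re, sub_im, mul_re, mul_im, ofReal_re, ofReal_im, intCast_re, intCast_im, I_re,
      I_im, zero_re, zero_im] at e₁ e₂
    constructor <;> linarith
  obtain ⟨hAa, hBc⟩ := key hA0
  obtain ⟨hAb, hBd⟩ := key hB0
  constructor
  · by_contra hA'
    have ha : a = 0 := by exact_mod_cast (mul_eq_zero.1 hAa).resolve_left hA'
    have hb : b = 0 := by exact_mod_cast (mul_eq_zero.1 hAb).resolve_left hA'
    have hx0 : (x : ℂ) = 0 := by rw [← hab, ha, hb]; simp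
    exact hx (ofReal_eq_zero.1 hx0)
  · by_contra hB'
    have hc : c = 0 := by exact_mod_cast (mul_eq_zero.1 hBc).resolve_left hB'
    have hd : d = 0 := by exact_mod_cast (mul_eq_zero.1 hBd).resolve_left hB'
    have hy0 : (y : ℂ) * I = 0 := by rw [← hcd, hc, hd]; simp
    exact hy (ofReal_eq_zero.1 ((mul_eq_zero.1 hy0).resolve_right I_ne_zero))

/-! ## §4 The stub -/

/-- **Stub Ic of line `Sketch` — the class kernel.** Given stub Ib (a REAL lattice multiplier between
nonsingular real-algebraic cubics is realised by a real-algebraic datum) as a hypothesis: inside ONE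
`ℂ`-isogeny class (every `Λⱼ`, `j ∈ S`, receives a non-zero complex multiple `μⱼΛ₀` of a lattice `Λ₀`
with real algebraic invariants `g₂ = −4α_{i₀}`, `g₃ = −4β_{i₀}`) of pairwise datum-UNRELATED
nonsingular real-algebraic cubics `y² = x³ + αⱼx + βⱼ`, a relation `∑_{j ∈ S} qⱼ Ωⱼ = 0` among the full
real periods `Ωⱼ = ∫_{Pⱼ>0} dx/√Pⱼ` with real algebraic `qⱼ` forces `qⱼ = 0` on `S`. Proof in the module
docstring: conjugation-symmetrised multipliers make every index of real or imaginary type, two indices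
of one type are joined by a real multiplier hence (Ib) equal, CM makes every index real (`|S| ≤ 1`,
`Ωⱼ > 0`), and without CM the two-term relation transported to `Λ₀ ∩ ℝ`, `Λ₀ ∩ iℝ` is killed by
Masser (`real_imag_relation`). [cite: Masser1975, Ch. II Thm. II] -/
theorem stub_algClassKernel : (∀ (α β α' β' : ℝ), IsAlgebraic ℚ α → IsAlgebraic ℚ β → IsAlgebraic ℚ α' → IsAlgebraic ℚ β' → 4 * α ^ 3 + 27 * β ^ 2 ≠ 0 → 4 * α' ^ 3 + 27 * β' ^ 2 ≠ 0 → ∀ (L L' : PeriodPair) (ν : ℝ), L.g₂ = -4 * (α : ℂ) → L.g₃ = -4 * (β : ℂ) → L'.g₂ = -4 * (α' : ℂ) → L'.g₃ = -4 * (β' : ℂ) → ν ≠ 0 → (∀ l ∈ L.lattice, (ν : ℂ) * l ∈ L'.lattice) → (∃ (f g : Polynomial ℝ) (c : ℝ), (∀ n, IsAlgebraic ℚ (f.coeff n)) ∧ (∀ n, IsAlgebraic ℚ (g.coeff n)) ∧ IsAlgebraic ℚ c ∧ Polynomial.derivative f * g - f * Polynomial.derivative g ≠ 0 ∧ Polynomial.C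 (c ^ 2) * g * (f ^ 3 + Polynomial.C α' * f * g ^ 2 + Polynomial.C β' * g ^ 3) = (Polynomial.X ^ 3 + Polynomial.C α * Polynomial.X + Polynomial.C β) * (Polynomial.derivative f * g - f * Polynomial.derivative g) ^ 2)) → ∀ (k : ℕ) (α β q : Fin k → ℝ) (S : Finset (Fin k)) (L₀ : PeriodPair) (i₀ : Fin k), (∀ i, IsAlgebraic ℚ (α i) ∧ IsAlgebraic ℚ (β i) ∧ IsAlgebraic ℚ (q i)) → (∀ i, 4 * α i ^ 3 + 27 * β i ^ 2 ≠ 0) → L₀.g₂ = -4 * ((α i₀ : ℝ) : ℂ) → L₀.g₃ = -4 * ((β i₀ : ℝ) : ℂ) → (∀ j ∈ S, ∃ (L' : PeriodPair) (μ : ℂ), L'.g₂ = -4 * ((α j : ℝ) : ℂ) ∧ L'.g₃ = -4 * ((β j : ℝ) : ℂ) ∧ μ ≠ 0 ∧ ∀ l ∈ L₀.lattice, μ * l ∈ L'.lattice) → (∀ i ∈ S, ∀ j ∈ S, i ≠ j → ¬ (∃ (f g : Polynomial ℝ) (c : ℝ), (∀ n, IsAlgebraic ℚ (f.coeff n)) ∧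 (∀ n, IsAlgebraic ℚ (g.coeff n)) ∧ IsAlgebraic ℚ c ∧ Polynomial.derivative f * g - f * Polynomial.derivative g ≠ 0 ∧ Polynomial.C (c ^ 2) * g * (f ^ 3 + Polynomial.C (α j) * f * g ^ 2 + Polynomial.C (β j) * g ^ 3) = (Polynomial.X ^ 3 + Polynomial.C (α i) * Polynomial.X + Polynomial.C (β i)) * (Polynomial.derivative f * g - f * Polynomial.derivative g) ^ 2)) → ∑ j ∈ S, q j * (∫ x in {x : Fin 1 → ℝ | 0 < x 0 ^ 3 + α j * x 0 + β j}, 1 / Real.sqrt (x 0 ^ 3 + α j * x 0 + β j)) = 0 → ∀ j ∈ S, q j = 0 := by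
  intro hIb k α β q S L₀ i₀ halg hns hg₂ hg₃ hmem hnd hsum
  classical
  -- (0) the real period lattices `Λⱼ`; `Ωⱼ = nⱼ Ω₀(Λⱼ)`, `nⱼ ∈ {1, 2}`, `Ω₀(Λⱼ) > 0`, `Ω₀(Λⱼ) ∈ Λⱼ`
  choose L hLg₂ hLg₃ hLreal hLΩ using fun j => PeriodRep.exists_periodPair (hns j)
  obtain ⟨n, hn⟩ : ∃ n : Fin k → ℕ,
      ∀ j, (⟨0, 0, 0, α j, β j⟩ : WeierstrassCurve ℝ).numRealComponents = n j := ⟨_, fun j => rfl⟩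
  have hn0 : ∀ j, (n j : ℝ) ≠ 0 := fun j => by
    rw [← hn j]
    exact_mod_cast (WeierstrassCurve.numRealComponents_pos _).ne'
  have hΩ : ∀ j, (∫ x in {x : Fin 1 → ℝ | 0 < x 0 ^ 3 + α j * x 0 + β j},
      1 / Real.sqrt (x 0 ^ 3 + α j * x 0 + β j)) = n j * (L j).minRealPeriod := fun j => by
    rw [hLΩ j, hn j]
  have hu : ∀ j, 0 < (L j).minRealPeriod := fun j => (hLreal j).minRealPeriod_pos
  have humem : ∀ j, ((L j).minRealPeriod : ℂ) ∈ (L j).lattice := fun j =>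
    (hLreal j).minRealPeriod_mem_lattice
  -- algebraic invariants; `Λ₀` is real
  have hqC : ∀ j, IsAlgebraic ℚ ((q j : ℝ) : ℂ) := fun j => by
    simpa using (halg j).2.2.algebraMap (A := ℂ)
  have h4 : ∀ t : ℝ, IsAlgebraic ℚ t → IsAlgebraic ℚ (-4 * (t : ℂ)) := fun t ht => by
    have htC : IsAlgebraic ℚ (t : ℂ) := by simpa using ht.algebraMap (A := ℂ)
    simpa using (isAlgebraic_int (R := ℚ) (A := ℂ) (-4)).mul htC
  have hL₀g₂ : IsAlgebraic ℚ L₀.g₂ := by rw [hg₂]; exact h4 _ (halg i₀).1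
  have hL₀g₃ : IsAlgebraic ℚ L₀.g₃ := by rw [hg₃]; exact h4 _ (halg i₀).2.1
  have hLg₂a : ∀ j, IsAlgebraic ℚ (L j).g₂ := fun j => by rw [hLg₂ j]; exact h4 _ (halg j).1
  have hLg₃a : ∀ j, IsAlgebraic ℚ (L j).g₃ := fun j => by rw [hLg₃ j]; exact h4 _ (halg j).2.1
  have hreal₀ : L₀.IsReal := PeriodPair.isReal_of_g₂_g₃_real PeriodPair.uniformization_unique_holds
    (by rw [hg₂]; simp) (by rw [hg₃]; simp)
  -- (1) the multipliers `μⱼΛ₀ ⊆ Λⱼ` (a lattice with the invariants of `Λⱼ` is `Λⱼ`), symmetrised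
  have hsym : ∀ j ∈ S, ∃ ν : ℝ, ν ≠ 0 ∧ ((∀ l ∈ L₀.lattice, (ν : ℂ) * l ∈ (L j).lattice) ∨
      (∀ l ∈ L₀.lattice, (ν : ℂ) * I * l ∈ (L j).lattice)) := by
    intro j hj
    obtain ⟨L', μ, h₂, h₃, hμ, hμL⟩ := hmem j hj
    have hlat : L'.lattice = (L j).lattice := PeriodPair.uniformization_unique_holds L' (L j)
      (h₂.trans (hLg₂ j).symm) (h₃.trans (hLg₃ j).symm)
    exact exists_real_or_imaginary_multiplier hreal₀ (hLreal j) hμ (fun l hl => hlat ▸ hμL l hl)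
  -- the real type `T j`; an index not of real type is of imaginary type
  obtain ⟨T, hT⟩ : ∃ T : Fin k → Prop, ∀ j, T j ↔
      ∃ ν : ℝ, ν ≠ 0 ∧ ∀ l ∈ L₀.lattice, (ν : ℂ) * l ∈ (L j).lattice := ⟨_, fun j => Iff.rfl⟩
  have hnotT : ∀ j ∈ S, ¬ T j →
      ∃ ν : ℝ, ν ≠ 0 ∧ ∀ l ∈ L₀.lattice, (ν : ℂ) * I * l ∈ (L j).lattice := by
    intro j hj hTj
    obtain ⟨ν, hν, h | h⟩ := hsym j hj
    · exact absurd ((hT j).2 ⟨ν, hν, h⟩) hTj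
    · exact ⟨ν, hν, h⟩
  -- (2) Ib and the pairwise hypothesis: a real multiplier `Λᵢ → Λⱼ` inside `S` forces `i = j`
  have hdat : ∀ i ∈ S, ∀ j ∈ S, ∀ ρ : ℝ, ρ ≠ 0 →
      (∀ l ∈ (L i).lattice, (ρ : ℂ) * l ∈ (L j).lattice) → i = j := by
    intro i hi j hj ρ hρ hρL
    by_contra hij
    exact hnd i hi j hj hij (hIb (α i) (β i) (α j) (β j) (halg i).1 (halg i).2.1 (halg j).1
      (halg j).2.1 (hns i) (hns j) (L i) (L j) ρ (hLg₂ i) (hLg₃ i) (hLg₂ j) (hLg₃ j) hρ hρL)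
  -- (3) at most one index of each type
  have hTT : ∀ i ∈ S, ∀ j ∈ S, T i → T j → i = j := by
    intro i hi j hj hTi hTj
    obtain ⟨ν, hν, hνL⟩ := (hT i).1 hTi
    obtain ⟨ν', hν', hν'L⟩ := (hT j).1 hTj
    obtain ⟨ρ, hρ, hρL⟩ := exists_real_multiplier_of_real_real hν hν' hνL hν'L
    exact hdat i hi j hj ρ hρ hρL
  have hII : ∀ i ∈ S, ∀ j ∈ S, ¬ T i → ¬ T j → i = j := by
    intro i hi j hj hTi hTj
    obtain ⟨ν, hν, hνL⟩ := hnotT i hi hTi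
    obtain ⟨ν', hν', hν'L⟩ := hnotT j hj hTj
    obtain ⟨ρ, hρ, hρL⟩ := exists_real_multiplier_of_imag_imag hν hν' hνL hν'L
    exact hdat i hi j hj ρ hρ hρL
  -- (4) CM: every index is of real type
  have hCMT : L₀.HasCM → ∀ j ∈ S, T j := by
    intro hCM j hj
    by_contra hTj
    obtain ⟨ν, hν, hνL⟩ := hnotT j hj hTj
    obtain ⟨ν', hν', hcm⟩ := exists_imaginary_multiplier_of_hasCM hreal₀ hCM
    obtain ⟨ρ, hρ, hρL⟩ := exists_real_multiplier_of_imag_cm hν hν' hcm hνL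
    exact hTj ((hT j).2 ⟨ρ, hρ, hρL⟩)
  -- (5) one real-type and one imaginary-type index: no CM, `S = {r, s}`, Masser
  have htwo : ∀ r ∈ S, ∀ s ∈ S, T r → ¬ T s → q r = 0 ∧ q s = 0 := by
    intro r hr s hs hTr hTs
    have hrs : r ≠ s := fun h => hTs (h ▸ hTr)
    have hCM : ¬ L₀.HasCM := fun h => hTs (hCMT h s hs)
    have hS : S = {r, s} := by
      refine Finset.Subset.antisymm (fun i hi => ?_)
        (Finset.insert_subset_iff.2 ⟨hr, Finset.singleton_subset_iff.2 hs⟩)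
      rw [Finset.mem_insert, Finset.mem_singleton]
      by_cases hTi : T i
      · exact Or.inl (hTT i hi r hr hTi hTr)
      · exact Or.inr (hII i hi s hs hTi hTs)
    have hrel : q r * (n r * (L r).minRealPeriod) + q s * (n s * (L s).minRealPeriod) = 0 := by
      rwa [hS, Finset.sum_pair hrs, hΩ r, hΩ s] at hsum
    -- transport `Ω₀(Λ_r)`, `Ω₀(Λ_s)` to `Λ₀` along the dual multipliers
    obtain ⟨ν, hν, hνL⟩ := (hT r).1 hTr
    obtain ⟨ν', hν', hν'L⟩ := hnotT s hs hTs
    obtain ⟨N, hN, hNL⟩ := exists_dual_multiplier (ofReal_ne_zero.2 hν) hνL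
    obtain ⟨N', hN', hN'L⟩ :=
      exists_dual_multiplier (mul_ne_zero (ofReal_ne_zero.2 hν') I_ne_zero) hν'L
    have hNr : (N : ℝ) ≠ 0 := Nat.cast_ne_zero.2 hN
    have hNs : (N' : ℝ) ≠ 0 := Nat.cast_ne_zero.2 hN'
    have hx : ((N / ν * (L r).minRealPeriod : ℝ) : ℂ) ∈ L₀.lattice := mod_cast hNL _ (humem r)
    have hy : ((-(N' / ν' * (L s).minRealPeriod) : ℝ) : ℂ) * I ∈ L₀.lattice := by
      rw [show ((-(N' / ν' * (L s).minRealPeriod) : ℝ) : ℂ) * I =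
          (N' : ℂ) / ((ν' : ℂ) * I) * ((L s).minRealPeriod : ℂ) by
        rw [div_eq_mul_inv (N' : ℂ), mul_inv, Complex.inv_I]; push_cast; ring]
      exact hN'L _ (humem s)
    have hx0 : N / ν * (L r).minRealPeriod ≠ 0 := mul_ne_zero (div_ne_zero hNr hν) (hu r).ne'
    have hy0 : -(N' / ν' * (L s).minRealPeriod) ≠ 0 :=
      neg_ne_zero.2 (mul_ne_zero (div_ne_zero hNs hν') (hu s).ne')
    -- the coefficients `A = q_r n_r ν / N`, `B = −q_s n_s ν' / N'` are real algebraic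
    have hνa := HuberWustholzSplitting.isAlgebraic_of_mul_mem_lattice hL₀g₂ hL₀g₃ (hLg₂a r)
      (hLg₃a r) (ofReal_ne_zero.2 hν) hνL
    have hν'a : IsAlgebraic ℚ (ν' : ℂ) :=
      isAlgebraic_of_imaginary_multiplier hL₀g₂ hL₀g₃ (hLg₂a s) (hLg₃a s) hν' hν'L
    have hA : IsAlgebraic ℚ ((q r * n r * ν / N : ℝ) : ℂ) := by
      rw [show ((q r * n r * ν / N : ℝ) : ℂ) = (q r : ℂ) * (n r : ℂ) * (ν : ℂ) * ((N : ℂ))⁻¹ by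
        push_cast; ring]
      exact (((hqC r).mul (isAlgebraic_nat (n r))).mul hνa).mul (isAlgebraic_nat N).inv
    have hB : IsAlgebraic ℚ ((-(q s * n s * ν' / N') : ℝ) : ℂ) := by
      rw [show ((-(q s * n s * ν' / N') : ℝ) : ℂ) = -((q s : ℂ) * (n s : ℂ) * (ν' : ℂ) * ((N' : ℂ))⁻¹) by
        push_cast; ring]
      exact ((((hqC s).mul (isAlgebraic_nat (n s))).mul hν'a).mul (isAlgebraic_nat N').inv).neg
    have h1 : ν / N * (N / ν) = 1 := by
      rw [div_mul_div_comm, div_eq_one_iff_eq (mul_ne_zero hNr hν), mul_comm]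
    have h2 : ν' / N' * (N' / ν') = 1 := by
      rw [div_mul_div_comm, div_eq_one_iff_eq (mul_ne_zero hNs hν'), mul_comm]
    have hrel' : q r * n r * ν / N * (N / ν * (L r).minRealPeriod) +
        -(q s * n s * ν' / N') * -(N' / ν' * (L s).minRealPeriod) = 0 := by
      calc _ = q r * n r * (ν / N * (N / ν)) * (L r).minRealPeriod +
            q s * n s * (ν' / N' * (N' / ν')) * (L s).minRealPeriod := by ring
        _ = 0 := by rw [h1, h2, ← hrel]; ring
    obtain ⟨hA0, hB0⟩ := real_imag_relation hL₀g₂ hL₀g₃ hCM hx0 hy0 hx hy hA hB hrel'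
    constructor
    · rcases mul_eq_zero.1 ((div_eq_zero_iff.1 hA0).resolve_right hNr) with h | h
      · exact (mul_eq_zero.1 h).resolve_right (hn0 r)
      · exact absurd h hν
    · rcases mul_eq_zero.1 ((div_eq_zero_iff.1 (neg_eq_zero.1 hB0)).resolve_right hNs) with h | h
      · exact (mul_eq_zero.1 h).resolve_right (hn0 s)
      · exact absurd h hν'
  -- (6) conclusion
  intro j hj
  by_cases hone : ∀ i ∈ S, i = j
  · have hsum' : q j * (n j * (L j).minRealPeriod) = 0 := by
      rwa [Finset.sum_eq_single_of_mem j hj (fun i hi hij => absurd (hone i hi) hij), hΩ j] at hsum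
    rcases mul_eq_zero.1 hsum' with h | h
    · exact h
    · exact absurd h (mul_ne_zero (hn0 j) (hu j).ne')
  · push Not at hone
    obtain ⟨i, hi, hij⟩ := hone
    by_cases hTj : T j
    · have hTi : ¬ T i := fun hTi => hij (hTT i hi j hj hTi hTj)
      exact (htwo j hj i hi hTj hTi).1
    · have hTi : T i := by_contra fun hTi => hij (hII i hi j hj hTi hTj)
      exact (htwo i hi j hj hTi hTj).2

end Summit.KontsevichZagierPeriods.IsogenyCertificates.AlgRealPeriodCell.ClassKernel

end
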